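import Literature.AlgebraicGeometry.Resolution.DifferentialOperators
import Mathlib.RingTheory.MvPolynomial.Ideal
import HarnessLib

/-!
# Hasse–Schmidt (divided, Taylor) derivatives on polynomial rings and the order criterion via `Diff^{≤ m−1}(I)`

Topic: `Literature/AlgebraicGeometry/Resolution`; definition item `defn-HasseSchmidtDiff`,
polynomial-ring layer over `DifferentialOperators.lean` (Grothendieck's `Diff^{≤ n}_{A/R}`,
`diffIdeal`). On `A = R[x_i : i ∈ σ]`, ANY commutative ring `R` (any characteristic):

* `taylor R : R[x] →ₐ[R] R[x][u]`, `f ↦ f(x + u)` (`u_i ↦` the variables of the outer polynomial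
  ring `MvPolynomial σ (MvPolynomial σ R)`), and the **Hasse–Schmidt derivatives**
  `hasseDeriv R α f := ` the coefficient of `u^α` in `f(x + u)` (`α : σ →₀ ℕ`), so that
  `f(x + u) = Σ_α (D^{(α)} f)(x) u^α` — Villamayor's Taylor operators `Δ^α`, EGA's `D_p`
  (`D_p(z^q) = (q choose p) z^{q−p}`, 16.11.2.1); `hasseDeriv_zero` (`D^{(0)} = id`),
  **`hasseDeriv_mul`** — the higher Leibniz rule `D^{(α)}(fg) = Σ_{β+γ=α} D^{(β)}f · D^{(γ)}g` (free:
  `taylor` is a ring morphism), `constantCoeff_hasseDeriv` (`(D^{(α)} f)(0) = coeff_α f`),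
  `hasseDeriv_X_pow` (`D^{(k e_i)}(x_i^n) = (n choose k) x_i^{n−k}`, so `D^{(p e_i)}(x_i^p) = 1` in
  characteristic `p`, where every FIRST-order derivation kills `x_i^p`);
* **`isDiffOpLE_hasseDeriv`** — `D^{(α)} ∈ Diff^{≤ |α|}` in every characteristic (from the Leibniz
  rule: `[D^{(α)}, g] = Σ_{β+γ=α, β≠0} (D^{(β)}g)·D^{(γ)}` has order `≤ |α| − 1` by induction);
* `HasseSchmidtDiff σ R n` — the `A`-submodule of `A →ₗ[R] A` spanned by the `D^{(α)}`, `|α| ≤ n`;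
  `hasseSchmidtDiff_le_diffOp` (proved) and the NAMED FACT `hasseSchmidtDiff_eq_diffOp` — for `σ`
  finite they are ALL of `Diff^{≤ n}` ("the `D_p`, `|p| ≤ m`, form a basis of `Diff^m`", EGA IV₄
  Thm. 16.11.2; Villamayor 2008 §2.6 / §3: "`{Δ^α : 0 ≤ |α| ≤ n}` is a basis of the free module
  `Diff^n(R)`");
* **`diffIdeal_le_idealOfVars_iff`** — THE ORDER CRITERION AT A RATIONAL POINT, every
  characteristic: for `m ≥ 1` and `𝔪 = (x_i)_i` (`MvPolynomial.idealOfVars`),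
  `Diff^{≤ m−1}(I) ⊆ 𝔪 ↔ I ⊆ 𝔪^m`, i.e. `ord_0 I ≥ m` iff `Diff^{≤ m−1}(I)` vanishes at `0`
  (Villamayor 2008 §4.1: "`Diff^{b−1}_k(I)` is a proper ideal if and only if `I` has order at least `b`";
  replaces the characteristic-zero Lemma 3.74 (3) of Kollár, whose iterated first derivatives
  are what `DerivativeIdealsOrder.lean` treats) — PROVED (`⇐` is `diffIdeal_le_pow_sub`, `⇒`: a
  monomial `x^β` of `f ∈ I` with `|β| < m` gives `(D^{(β)} f)(0) = coeff_β f ≠ 0`).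

## Design notes

* `D^{(α)}` is DEFINED through the Taylor morphism (not by the binomial formula on monomials), which
  makes linearity and the Leibniz rule definitional consequences of `taylor` being an `R`-algebra
  map; the binomial values are recovered in `hasseDeriv_X_pow`. Declared in this namespace (not as
  `MvPolynomial.hasseDeriv`: Mathlib has the one-variable `Polynomial.hasseDeriv`, and a
  sub-namespace `….Resolution.MvPolynomial` would shadow `open MvPolynomial`, cf.
  `DerivativeIdealsOrder.lean`).
* The order criterion is proved at the ORIGIN of affine space (and at every `R`-point by the
  translations of `DerivativeIdealsOrder.exists_algEquiv_translate`, `Diff^{≤ n}` being transported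
  by `R`-algebra isomorphisms — not restated); Villamayor's statement at an arbitrary closed point
  of a smooth scheme over a PERFECT field reduces to it in étale coordinates (perfectness = the
  residue field extension is separable), which needs the sheaf `Diff^{≤ n}_{X/k}` and is not here.
* `HasseSchmidtDiff` is the notion name of the request; the equality with `diffOp` is the only
  unproved statement of the two files (a basis theorem, EGA IV₄ 16.11.2, not needed for the
  inclusion `Diff ⊇` nor for the order criterion, both proved).

## References

* [EGAIV4] ÉGA IV₄, Thm. 16.11.2 with (16.11.2.1) `D_p(z^q) = (q choose p) z^{q−p}` and (16.11.2.2)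
  (held copy pp. 53–54); Prop. 16.8.8.
* [VillamayorU2008ReesDiff] O. Villamayor U., Rev. Mat. Iberoam. 24 (2008) = arXiv:math/0606795,
  §2.6 ("`Tay(f(X)) = Σ Δ^α(f(X)) U^α` … `{Δ^α, 0 ≤ α ≤ N}` is a basis of the `B`-module of
  `S`-differential operators on `B`, of order `≤ N`"), §3 (p. 7: Taylor on a regular system of
  parameters, `k` perfect), §4.1 (order via `Diff^{b−1}_k(I)`).
* [Kollar2007] J. Kollár, *Lectures on resolution of singularities*, Lemma 3.74 (3) ("char. 0 only").
-/

open MvPolynomial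

namespace Literature.AlgebraicGeometry.Resolution

section Taylor

variable {σ : Type*} (R : Type*) [CommRing R]

/-! ### The Taylor morphism and the Hasse–Schmidt derivatives -/

/-- **The Taylor morphism** `f(x) ↦ f(x + u)`: the `R`-algebra map `R[x_i] → (R[x_i])[u_i]`,
`x_i ↦ x_i + u_i` (the outer variables `MvPolynomial.X i` of `MvPolynomial σ (MvPolynomial σ R)`
are the `u_i`, the constants `C (X i)` the `x_i`). [cite: VillamayorU2008ReesDiff, §2.6 (Tay : B → B[U], Tay(X) = X + U)] -/
noncomputable def taylor : MvPolynomial σ R →ₐ[R] MvPolynomial σ (MvPolynomial σ R) :=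
  aeval fun i => C (X i) + X i

/-- `taylor (x_i) = x_i + u_i`. [cite: VillamayorU2008ReesDiff, §2.6] -/
@[simp] theorem taylor_X (i : σ) : taylor R (X i : MvPolynomial σ R) = C (X i) + X i :=
  aeval_X _ i

/-- `taylor` is the identity on constants. [cite: VillamayorU2008ReesDiff, §2.6] -/
@[simp] theorem taylor_C (r : R) : taylor R (C r : MvPolynomial σ R) = C (C r) := by
  rw [taylor, aeval_C]; rfl

/-- **The Hasse–Schmidt derivative `D^{(α)}`** (divided / Taylor differential operator `Δ^α`):
`D^{(α)} f` is the coefficient of `u^α` in `f(x + u)`, so that `f(x + u) = Σ_α (D^{(α)}f)(x)·u^α`; an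
`R`-linear endomorphism of `R[x_i : i ∈ σ]`, in every characteristic (no division by `α!`).
[cite: VillamayorU2008ReesDiff, §2.6 (Tay(f(X)) = Σ Δ^α(f(X)) U^α)]
[cite: EGAIV4, Thm. 16.11.2 (the operators D_p, (16.11.2.1))] -/
noncomputable def hasseDeriv (α : σ →₀ ℕ) : MvPolynomial σ R →ₗ[R] MvPolynomial σ R :=
  ((lcoeff (MvPolynomial σ R) α).restrictScalars R) ∘ₗ (taylor R).toLinearMap

/-- `D^{(α)} f = coeff_{u^α} f(x + u)` (definitional). [cite: VillamayorU2008ReesDiff, §2.6] -/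
theorem hasseDeriv_apply (α : σ →₀ ℕ) (f : MvPolynomial σ R) :
    hasseDeriv R α f = coeff α (taylor R f) :=
  rfl

/-- **The higher Leibniz rule**: `D^{(α)}(f g) = Σ_{β+γ=α} D^{(β)} f · D^{(γ)} g` (the Taylor
morphism is multiplicative). [cite: EGAIV4, Thm. 16.11.2 (16.11.2.2) and Prop. 16.8.8]
[cite: VillamayorU2008ReesDiff, §3 (proof of Thm. 3.4, case 2: Δ^α(a·H) = Σ Δ^{α₁}(a) Δ^{α₂}(H))] -/
theorem hasseDeriv_mul [DecidableEq σ] (α : σ →₀ ℕ) (f g : MvPolynomial σ R) :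
    hasseDeriv R α (f * g) =
      ∑ p ∈ Finset.antidiagonal α, hasseDeriv R p.1 f * hasseDeriv R p.2 g := by
  simp only [hasseDeriv_apply, map_mul, coeff_mul]

/-- Setting `u = 0` after Taylor expansion gives back `f`: `constantCoeff_u ∘ taylor = id`.
[cite: VillamayorU2008ReesDiff, §2.6] -/
theorem constantCoeff_comp_taylor :
    (constantCoeff : MvPolynomial σ (MvPolynomial σ R) →+* MvPolynomial σ R).comp
      (taylor R (σ := σ)).toRingHom = RingHom.id _ := by
  refine MvPolynomial.ringHom_ext (fun r => ?_) (fun i => ?_)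
  · simp
  · simp

/-- **`D^{(0)} = id`** (`f(x + 0) = f(x)`). [cite: EGAIV4, Thm. 16.11.2 (D_0 = 1)] -/
@[simp] theorem hasseDeriv_zero_apply (f : MvPolynomial σ R) : hasseDeriv R 0 f = f := by
  have h := RingHom.congr_fun (constantCoeff_comp_taylor R (σ := σ)) f
  rw [RingHom.comp_apply, RingHom.id_apply] at h
  exact h

/-- `D^{(0)} = id` as linear maps. [cite: EGAIV4, Thm. 16.11.2] -/
theorem hasseDeriv_zero : hasseDeriv R (0 : σ →₀ ℕ) = LinearMap.id :=
  LinearMap.ext (hasseDeriv_zero_apply R)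

/-- Setting `x = 0` after Taylor expansion gives back `f(u)`: `(map constantCoeff) ∘ taylor = id`
(renaming `u` to `x`). [cite: VillamayorU2008ReesDiff, §2.6] -/
theorem map_constantCoeff_comp_taylor :
    (MvPolynomial.map (constantCoeff : MvPolynomial σ R →+* R)).comp
        (taylor R (σ := σ)).toRingHom = RingHom.id _ := by
  refine MvPolynomial.ringHom_ext (fun r => ?_) (fun i => ?_)
  · simp
  · simp

/-- **The value of `D^{(α)} f` at the origin is the coefficient of `x^α` in `f`**
(`f(0 + u) = Σ_α coeff_α(f) u^α`). [cite: VillamayorU2008ReesDiff, §4.1 (proof: check at the local ring / power series)] -/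
theorem constantCoeff_hasseDeriv (α : σ →₀ ℕ) (f : MvPolynomial σ R) :
    constantCoeff (hasseDeriv R α f) = coeff α f := by
  have h : MvPolynomial.map constantCoeff (taylor R f) = f := by
    have := RingHom.congr_fun (map_constantCoeff_comp_taylor R (σ := σ)) f
    rwa [RingHom.comp_apply, RingHom.id_apply] at this
  calc constantCoeff (hasseDeriv R α f)
        = coeff α (MvPolynomial.map constantCoeff (taylor R f)) := by
          rw [coeff_map, hasseDeriv_apply]
    _ = coeff α f := by rw [h]

/-- **Binomial values**: `D^{(k·e_i)}(x_i^n) = (n choose k) · x_i^{n−k}` (the coefficient of `u_i^k`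
in `(x_i + u_i)^n`); in particular `D^{(p·e_i)}(x_i^p) = 1` in characteristic `p`.
[cite: EGAIV4, Thm. 16.11.2 (16.11.2.1: D_p(z^q) = (q choose p) z^{q-p})] -/
theorem hasseDeriv_X_pow [DecidableEq σ] (i : σ) (k n : ℕ) :
    hasseDeriv R (Finsupp.single i k) (X i ^ n : MvPolynomial σ R) =
      (n.choose k : MvPolynomial σ R) * X i ^ (n - k) := by
  rw [hasseDeriv_apply, map_pow, taylor_X, add_comm, add_pow, coeff_sum]
  -- the `j`-th term `u_i^j x_i^{n-j} (n choose j)` contributes iff `j = k`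
  have hterm : ∀ j ∈ Finset.range (n + 1),
      coeff (Finsupp.single i k)
          ((X i : MvPolynomial σ (MvPolynomial σ R)) ^ j * C (X i) ^ (n - j) *
            (n.choose j : MvPolynomial σ (MvPolynomial σ R))) =
        if j = k then (n.choose k : MvPolynomial σ R) * X i ^ (n - k) else 0 := by
    intro j _
    have hC : (X i : MvPolynomial σ (MvPolynomial σ R)) ^ j * C (X i) ^ (n - j) *
          (n.choose j : MvPolynomial σ (MvPolynomial σ R)) =
        C ((n.choose j : MvPolynomial σ R) * X i ^ (n - j)) * X i ^ j := by
      rw [map_mul, map_pow, map_natCast]; ring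
    rw [hC, coeff_C_mul, coeff_X_pow]
    by_cases hjk : j = k
    · subst hjk; simp
    · rw [if_neg (fun h => hjk (Finsupp.single_injective i h)), if_neg hjk, mul_zero]
  rw [Finset.sum_congr rfl hterm, Finset.sum_ite_eq' (Finset.range (n + 1)) k]
  split_ifs with hk
  · rfl
  · rw [Finset.mem_range, not_lt] at hk
    rw [Nat.choose_eq_zero_of_lt (by omega), Nat.cast_zero, zero_mul]

/-! ### Hasse–Schmidt derivatives are differential operators of order `≤ |α|` -/

/-- **The commutator of `D^{(α)}` with a multiplication**: `[D^{(α)}, g] = Σ_{β+γ=α, (β,γ)≠(0,α)}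
(D^{(β)} g) · D^{(γ)}` — a combination of Hasse–Schmidt derivatives of STRICTLY smaller order
(Leibniz rule minus its `β = 0` term). [cite: EGAIV4, Prop. 16.8.8 (b) with Thm. 16.11.2] -/
theorem commMul_hasseDeriv [DecidableEq σ] (α : σ →₀ ℕ) (g : MvPolynomial σ R) :
    commMul R (hasseDeriv R α) g =
      ∑ p ∈ (Finset.antidiagonal α).erase (0, α), hasseDeriv R p.1 g • hasseDeriv R p.2 := by
  refine LinearMap.ext fun t => ?_
  have h0 : ((0 : σ →₀ ℕ), α) ∈ Finset.antidiagonal α := by simp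
  rw [commMul_apply, hasseDeriv_mul, ← Finset.add_sum_erase _ _ h0, LinearMap.sum_apply]
  simp only [hasseDeriv_zero_apply, LinearMap.smul_apply, smul_eq_mul]
  ring

/-- On the punctured antidiagonal the second component has smaller degree. [folklore] -/
theorem degree_snd_lt_of_mem_erase_antidiagonal [DecidableEq σ] {α : σ →₀ ℕ}
    {p : (σ →₀ ℕ) × (σ →₀ ℕ)} (hp : p ∈ (Finset.antidiagonal α).erase (0, α)) :
    p.2.degree < α.degree := by
  obtain ⟨hne, hp⟩ := Finset.mem_erase.1 hp
  rw [Finset.mem_antidiagonal] at hp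
  have h1 : p.1 ≠ 0 := by
    intro h1
    apply hne
    rw [h1, zero_add] at hp
    exact Prod.ext h1 hp
  have h1' : 0 < p.1.degree :=
    Nat.pos_of_ne_zero fun h => h1 ((Finsupp.degree_eq_zero_iff _).1 h)
  have hdeg : α.degree = p.1.degree + p.2.degree := by rw [← hp, map_add]
  omega

/-- **`D^{(α)}` is a differential operator of order `≤ |α|`, in every characteristic** (induction on
`|α|` through `commMul_hasseDeriv`). [cite: EGAIV4, Thm. 16.11.2 (the D_p are differential operators; |p| ≤ m ⇒ D_p ∈ Diff^m)]
[cite: VillamayorU2008ReesDiff, §2.6 (Δ^α is an S-differential operator of order ≤ N for α ≤ N)] -/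
theorem isDiffOpLE_hasseDeriv [DecidableEq σ] :
    ∀ (n : ℕ) (α : σ →₀ ℕ), α.degree ≤ n → IsDiffOpLE R n (hasseDeriv R α)
  | 0, α, hα => by
    have : α = 0 := (Finsupp.degree_eq_zero_iff α).1 (Nat.le_zero.1 hα)
    subst this
    rw [hasseDeriv_zero]
    exact isDiffOpLE_id
  | n + 1, α, hα => fun g => by
    rw [commMul_hasseDeriv]
    refine IsDiffOpLE.sum _ fun p hp => IsDiffOpLE.smul _ (isDiffOpLE_hasseDeriv n p.2 ?_)
    have := degree_snd_lt_of_mem_erase_antidiagonal hp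
    omega

/-- `D^{(α)} ∈ Diff^{≤ |α|}`. [cite: EGAIV4, Thm. 16.11.2] -/
theorem hasseDeriv_mem_diffOp [DecidableEq σ] (α : σ →₀ ℕ) :
    hasseDeriv R α ∈ diffOp R (MvPolynomial σ R) α.degree :=
  isDiffOpLE_hasseDeriv R _ α le_rfl

/-- Hence `D^{(α)} f ∈ Diff^{≤ n}(I)` for `f ∈ I` and `|α| ≤ n`. [cite: VillamayorU2008ReesDiff, §4.1 ((Diff^{b-1}(I))_x = ⟨Δ^α(f) : f ∈ I, |α| ≤ b-1⟩, inclusion ⊇)] -/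
theorem hasseDeriv_apply_mem_diffIdeal [DecidableEq σ] {n : ℕ} {α : σ →₀ ℕ} (hα : α.degree ≤ n)
    {I : Ideal (MvPolynomial σ R)} {f : MvPolynomial σ R} (hf : f ∈ I) :
    hasseDeriv R α f ∈ diffIdeal R n I :=
  apply_mem_diffIdeal R (isDiffOpLE_hasseDeriv R n α hα) hf

/-! ### The module spanned by the Hasse–Schmidt derivatives -/

variable (σ)

/-- **`HasseSchmidtDiff σ R n`**: the `R[x]`-submodule of `R[x] →ₗ[R] R[x]` spanned by the
Hasse–Schmidt derivatives `D^{(α)}` with `|α| ≤ n` — the explicit presentation of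
`Diff^{≤ n}_{R[x]/R}` by a basis (EGA IV₄ 16.11.2: "si `L` est fini, pour tout entier `m`, les `D_p`
tels que `|p| ≤ m` forment une base du `𝒪_U`-Module `Diff^m`"). Contained in `diffOp`
(`hasseSchmidtDiff_le_diffOp`, proved); equal to it for finitely many variables
(`hasseSchmidtDiff_eq_diffOp`, named fact). [cite: EGAIV4, Thm. 16.11.2]
[cite: VillamayorU2008ReesDiff, §2.6 ({Δ^α, 0 ≤ α ≤ N} is a basis of the S-differential operators of order ≤ N)] -/
noncomputable def HasseSchmidtDiff (n : ℕ) :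
    Submodule (MvPolynomial σ R) (MvPolynomial σ R →ₗ[R] MvPolynomial σ R) :=
  Submodule.span (MvPolynomial σ R) {D | ∃ α : σ →₀ ℕ, α.degree ≤ n ∧ hasseDeriv R α = D}

/-- The generators. [cite: EGAIV4, Thm. 16.11.2] -/
theorem hasseDeriv_mem_hasseSchmidtDiff {n : ℕ} {α : σ →₀ ℕ} (hα : α.degree ≤ n) :
    hasseDeriv R α ∈ HasseSchmidtDiff σ R n :=
  Submodule.subset_span ⟨α, hα, rfl⟩

/-- **`HasseSchmidtDiff ⊆ Diff^{≤ n}`** (every characteristic). [cite: EGAIV4, Thm. 16.11.2] -/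
theorem hasseSchmidtDiff_le_diffOp [DecidableEq σ] (n : ℕ) :
    HasseSchmidtDiff σ R n ≤ diffOp R (MvPolynomial σ R) n := by
  refine Submodule.span_le.2 ?_
  rintro _ ⟨α, hα, rfl⟩
  exact isDiffOpLE_hasseDeriv R n α hα

/-- **The Hasse–Schmidt derivatives of order `≤ n` span ALL differential operators of order `≤ n`
of a polynomial ring in finitely many variables** (they even form a basis): EGA IV₄ Thm. 16.11.2
("les `D_p` tels que `|p| ≤ m` forment une base du `𝒪_U`-Module `Diff^m`", for a differentially
smooth morphism with finite basis `(dz_λ)` of `Ω¹`, e.g. `𝔸^L_R → Spec R`), Villamayor 2008 §2.6 /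
§3. Named fact (the basis theorem needs the modules of principal parts; only the inclusion `⊇`,
`hasseSchmidtDiff_le_diffOp`, is proved in the tree). [cite: EGAIV4, Thm. 16.11.2] -/
def hasseSchmidtDiff_eq_diffOp : Prop :=
  ∀ (σ : Type) [Fintype σ] [DecidableEq σ] (R : Type) [CommRing R] (n : ℕ),
    HasseSchmidtDiff σ R n = diffOp R (MvPolynomial σ R) n

variable {σ}

/-! ### The order criterion at the origin, every characteristic -/

/-- Elements of `𝔪 = (x_i)_i` have no constant term. [folklore] -/
theorem coeff_zero_eq_zero_of_mem_idealOfVars {f : MvPolynomial σ R} (hf : f ∈ idealOfVars σ R) :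
    coeff 0 f = 0 := by
  rw [← pow_one (idealOfVars σ R), mem_pow_idealOfVars_iff'] at hf
  exact hf 0 (by simp)

/-- **Order criterion at the origin of `𝔸^σ_R` (any commutative ring `R`, any characteristic).**
For `m ≥ 1`: `Diff^{≤ m−1}(I) ⊆ 𝔪 ↔ I ⊆ 𝔪^m`, `𝔪 = (x_i)_{i ∈ σ}` — i.e. `ord_0 I ≥ m` iff every
differential operator of order `≤ m − 1` maps `I` into `𝔪`. `⇐`: `diffIdeal_le_pow_sub`; `⇒`: if
`f ∈ I` has a monomial `x^β`, `|β| < m`, with nonzero coefficient, then `D^{(β)} f ∈ Diff^{≤ m−1}(I)`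
has constant term `coeff_β f ≠ 0`. (Villamayor: "`Diff^{b−1}_k(I)` is a proper ideal if and only if
`I` has order at least `b` at the local ring"; Kollár 3.74 (3) is the characteristic-`0` case with
iterated first derivatives.) [cite: VillamayorU2008ReesDiff, §4.1] -/
theorem diffIdeal_le_idealOfVars_iff [DecidableEq σ] {I : Ideal (MvPolynomial σ R)} {m : ℕ}
    (hm : m ≠ 0) : diffIdeal R (m - 1) I ≤ idealOfVars σ R ↔ I ≤ idealOfVars σ R ^ m := by
  constructor
  · intro h f hf
    rw [mem_pow_idealOfVars_iff']
    intro β hβ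
    by_contra hne
    have hD : hasseDeriv R β f ∈ idealOfVars σ R :=
      h (hasseDeriv_apply_mem_diffIdeal R (by omega) hf)
    exact hne (by rw [← constantCoeff_hasseDeriv, constantCoeff_eq,
      coeff_zero_eq_zero_of_mem_idealOfVars R hD])
  · intro h
    have := diffIdeal_le_pow_sub R h (m - 1)
    rwa [show m - (m - 1) = 1 by omega, pow_one] at this

/-- The same with `n = m − 1`: `Diff^{≤ n}(I) ⊆ 𝔪 ↔ I ⊆ 𝔪^{n+1}`. [cite: VillamayorU2008ReesDiff, §4.1] -/
theorem diffIdeal_le_idealOfVars_iff' [DecidableEq σ] {I : Ideal (MvPolynomial σ R)} (n : ℕ) :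
    diffIdeal R n I ≤ idealOfVars σ R ↔ I ≤ idealOfVars σ R ^ (n + 1) := by
  simpa using diffIdeal_le_idealOfVars_iff R (I := I) (m := n + 1) (Nat.succ_ne_zero n)

/-- **Tame points, ring form**: if `ord_0 I = m ≥ 1` exactly (`I ⊆ 𝔪^m`, `I ⊄ 𝔪^{m+1}`) then some
Hasse–Schmidt derivative of order `≤ m` of an element of `I` is a unit at `0`, i.e.
`Diff^{≤ m}(I) ⊄ 𝔪`, while `Diff^{≤ m−1}(I) ⊆ 𝔪`. [cite: VillamayorU2008ReesDiff, §4.1 and Remark 4.3] -/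
theorem diffIdeal_not_le_idealOfVars_of_not_le_pow_succ [DecidableEq σ]
    {I : Ideal (MvPolynomial σ R)} {m : ℕ} (h : ¬ I ≤ idealOfVars σ R ^ (m + 1)) :
    ¬ diffIdeal R m I ≤ idealOfVars σ R :=
  fun h' => h ((diffIdeal_le_idealOfVars_iff' R m).1 h')

end Taylor

end Literature.AlgebraicGeometry.Resolution
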